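import Literature.NumberTheory.LFunctions.GuthMaynardSimpleS3BoundProofs
import HarnessLib

/-!
# Guth–Maynard Proposition 10.1 (the refined `S₃` bound) AS PRINTED, with `T` free — stated and proved

NOT RH-BEARING (D-0040; bears_on LADDER-RH §4 HELD `DensityLadder`): a large-values / zero-density result
counts zeros off the critical line, it never empties the strip
(`Literature.Barriers.RiemannHypothesis.LindelofBacklund`); nothing in this file bears on the truth of RH.

Topic `NumberTheory/LFunctions`. L. Guth, J. Maynard, *New large value estimates for Dirichlet
polynomials*, Ann. of Math. (2) 203 (2026) = arXiv:2405.20552, **Proposition 10.1** (eq. (10.1)):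
"If `W` is a `T^ε`-separated set contained in an interval of length `T`, then
`S₃ ⪅_ε T²|W|^{3/2} + TN|W|^{1/2}E(W)^{1/2}`." The tree PROVES this in the standing regime `T = N^{6/5}`
of Proposition 3.1 (`GuthMaynardS3Final.S3_bound`, `LargeValuesS3Bound.lean`, the input of Theorem 1.2's
discharge). Here the statement is typed AS PRINTED with `T` a free parameter
(`def GuthMaynard2026_proposition_10_1`: all `T ≥ T₀(ε,δ)`, all `1 ≤ N ≤ T`, the large-values regime of
§3) and PROVED (`GuthMaynard2026_proposition_10_1_holds`) — the `S₃` input of eq. (12.1) with `T` free,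
which Proposition 12.1 (`N ∈ [T^{5/6}, T]`) uses.

## Proof

For `T ≤ N⁶` the tree's proof of Proposition 10.1 is re-run with `T` free (namespace `GuthMaynardS3FreeT`):
* `main_block_freeT` — one dyadic block of Proposition 7.2 localised at `B = N2^{ib}N^{-η}`
  (`GuthMaynardS3Blocks.block_sum_le_snd/fst`: Hölder / Cauchy–Schwarz), Proposition 9.1
  (`GuthMaynardAffine.affine_equidistribution`) for `f_B` (admissible by Lemma 8.4,
  `GuthMaynardSmoothR.norm_fourier_fB_le_decay`) at the scale `T_a = 48TN^η ≤ 48N^{13/2}`, so that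
  `T_a^{η/2} ≤ 7N^{4η}` and the tree's block arithmetic `GuthMaynardS3Final.main_block_alg` applies verbatim
  with `L = N^{4η}`; Lemmas 8.2–8.3 (`integral_gW_le_card`, `integral_gW_sq_le_energy`);
* `block_bound_freeT` — negligible far blocks (`majorant_le_of_far_block`) or `main_block_freeT`;
* `S3_bound_of_le_pow_six` — truncation (7.2) with `T` free (`GuthMaynardSimpleS3.trunc_total_freeT`),
  the `O(N^{18η})` blocks, the negligible total; losses `N^{34η} ≤ N^δ`.
For `N⁶ ≤ T` the trivial bound `|S₃| ≪ N³|W|³ ≤ T^{1/2}|W|³ ≤ 3T²|W|^{3/2}`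
(`GuthMaynardSimpleS3.norm_S3_le_trivial`). The `T^ε`-separation is used only through `1`-separation.

One definition (`GuthMaynard2026_proposition_10_1`, discharged in this file: net debt 0); no named fact
left unproved. Deliberately NOT here: Proposition 6.1 (`S₂`) with `T` free and eq. (12.1) with `T` free.

## References

* L. Guth, J. Maynard, *New large value estimates for Dirichlet polynomials*, Ann. of Math. (2) 203
  (2026), no. 2, 623–675; arXiv:2405.20552 (2024): §7 (Proposition 7.2), §9 (Proposition 9.1), §10
  (Proposition 10.1, eq. (10.1), and its proof), §12 (eq. (12.1), Proposition 12.1). [key `GuthMaynard2026`]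
-/

noncomputable section

open Finset hiding addEnergy
open Real Set Filter MeasureTheory Complex
open scoped FourierTransform ContDiff Convolution

namespace Literature.NumberTheory.LFunctions

namespace GuthMaynardS3FreeT

open GuthMaynardFourier GuthMaynardRFunction GuthMaynardS3 GuthMaynardSmoothR GuthMaynardS3Loc
  GuthMaynardAffine GuthMaynardS3Blocks GuthMaynardS3Final GuthMaynardAssembly GuthMaynardSimpleS3

set_option maxHeartbeats 3200000 in
/-- **One main block, `T` free** (the tree's `GuthMaynardS3Final.main_block` is the case `T = N^{6/5}`):
for a block `shell ia × shell ib × shell i₃` (or its swap), `ia ≤ ib`, `i₃ ≤ ib + 4`, localised at the scale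
`B = N2^{ib}N^{-η}`, with `N ≤ T ≤ N⁶`, `|W| ≤ 2T`, `NM₀ ≤ 3TN^η`, the analytic bound of
`GuthMaynardS3Blocks.block_sum_le_*` is at most `A₁ N^{16η} 𝒯`, `𝒯 = T²|W|^{3/2} + TN|W|^{1/2}E(W)^{1/2}`,
once Proposition 9.1 (`GuthMaynardAffine.affine_equidistribution`, for `f_B`, admissible by Lemma 8.4, at the
scale `T_a = 48TN^η`, `T_a^{η/2} ≤ 7N^{4η}`) and Lemmas 8.2–8.3 are inserted (`main_block_alg` at `L = N^{4η}`).
[cite: GuthMaynard2026, proof of Proposition 10.1] -/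
theorem main_block_freeT {η C₉ T₉ C_F C₂ C₄ C_b : ℝ} {j : ℕ} (hη0 : 0 < η) (hη12 : η ≤ 1 / 2)
    (hC₉1 : 1 ≤ C₉)
    (hC₉ : ∀ T : ℝ, T₉ ≤ T → ∀ M : ℝ, 1 ≤ M → M ≤ T →
      ∀ f : ℝ → ℝ, ContDiff ℝ ∞ f → HasCompactSupport f → (∀ x, 0 ≤ f x) →
      (∀ x, f x ≠ 0 → 1 / 16 ≤ x ∧ x ≤ 9 / 2) →
      (∀ ζ : ℝ, ζ ≠ 0 → ‖𝓕 (fun y ↦ ((f y : ℝ) : ℂ)) ζ‖ ≤ T ^ 2 * (∫ y, f y) * (T / |ζ|) ^ 4) →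
      ∀ (I₁ I₂ : Finset ℤ) (M₁ M₂ : ℝ) (M₃ : ℕ), 1 ≤ M₁ → M₁ ≤ M → 1 ≤ M₂ → M₂ ≤ M → (M₃ : ℝ) ≤ 23 * M →
      (∀ m ∈ I₁, M₁ ≤ |(m : ℝ)| ∧ |(m : ℝ)| ≤ 2 * M₁) → (∀ m ∈ I₂, M₂ ≤ |(m : ℝ)| ∧ |(m : ℝ)| ≤ 2 * M₂) →
      Jfun f I₁ I₂ M₃ ≤ C₉ * T ^ η * (M ^ 6 * (∫ y, f y) ^ 2 + M ^ 4 * ∫ y, f y ^ 2))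
    (hCF : ∀ (W : Finset ℝ) (B : ℝ), 0 < B → ∀ ξ : ℝ, ξ ≠ 0 →
      ‖𝓕 (fun x ↦ ((fB W B x : ℝ) : ℂ)) ξ‖ ≤ C_F * (B / |ξ|) ^ 4 * ∫ u, gW W u)
    (hC₂1 : 1 ≤ C₂) (hC₄1 : 1 ≤ C₄) (hηj : 2 ≤ η * ((j : ℝ) - 1))
    (hC₄ : ∀ (W : Finset ℝ) (D : ℝ), 1 ≤ D → ∫ u, gW W u ^ 2 ≤ C₄ * D * addEnergy W + C₄ * D / D ^ j * (W.card : ℝ) ^ 4)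
    (hC_b0 : 0 ≤ C_b)
    {N : ℕ} (hN : (2304 : ℝ) ≤ N) (hNT₉ : T₉ ≤ N) (hNCF : C_F ≤ (∫ x, psi1 x) * N)
    {T : ℝ} (hNT : (N : ℝ) ≤ T) (hT6 : T ≤ (N : ℝ) ^ (6 : ℝ))
    (W : Finset ℝ) (hC₂W : ∫ u, gW W u ≤ C₂ * W.card) (hKT : (W.card : ℝ) ≤ 2 * T)
    {M₀ : ℕ} (hNM₀ : (N : ℝ) * M₀ ≤ 3 * T * (N : ℝ) ^ η)
    {ia ib i₃ : ℕ} (hia : ia ≤ ib) (hi₃ : i₃ ≤ ib + 4) (hib : (2 : ℝ) ^ ib ≤ M₀) :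
    C_b * ((N : ℝ) ^ 3 / ((N : ℝ) * 2 ^ ib / (N : ℝ) ^ η)) *
        ((∫ u, gW W u) ^ (1 / 2 : ℝ) *
          (4 * Jfun (fB W ((N : ℝ) * 2 ^ ib / (N : ℝ) ^ η)) (shell M₀ i₃) (shell M₀ ib) (2 ^ (ia + 1))) ^ (1 / 4 : ℝ) *
          (Jfun (fB W ((N : ℝ) * 2 ^ ib / (N : ℝ) ^ η)) (shell M₀ ia) (shell M₀ ib) (2 ^ (i₃ + 1))) ^ (1 / 4 : ℝ)) ≤
      (10 ^ 6 * C_b * C₂ ^ 2 * C₉ * (max (∫ x, psi1 x) 1) * C₄) * ((N : ℝ) ^ η) ^ 16 *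
        (T ^ 2 * (W.card : ℝ) ^ (3 / 2 : ℝ) +
          T * N * (W.card : ℝ) ^ (1 / 2 : ℝ) * (addEnergy W) ^ (1 / 2 : ℝ)) := by
  -- basic quantities
  have hn1 : (1 : ℝ) ≤ N := by linarith
  have hn0 : (0 : ℝ) < N := by linarith
  have hnle : ∀ {x y : ℝ}, x ≤ y → (N : ℝ) ^ x ≤ (N : ℝ) ^ y := fun h ↦ Real.rpow_le_rpow_of_exponent_le hn1 h
  have hnp : ∀ x y : ℝ, (N : ℝ) ^ x * (N : ℝ) ^ y = (N : ℝ) ^ (x + y) := fun x y ↦ (Real.rpow_add hn0 x y).symm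
  have hT1 : 1 ≤ T := hn1.trans hNT
  have hT0 : 0 < T := by linarith
  set L : ℝ := (N : ℝ) ^ η with hL
  have hL1 : 1 ≤ L := Real.one_le_rpow hn1 hη0.le
  have hL0 : 0 < L := by linarith
  have hLhalf : L ≤ (N : ℝ) ^ (1 / 2 : ℝ) := hnle hη12
  set K : ℝ := (W.card : ℝ) with hK
  have hK0 : 0 ≤ K := Nat.cast_nonneg _
  set E : ℝ := addEnergy W with hE
  have hE0 : 0 ≤ E := addEnergy_nonneg W
  set P₁ : ℝ := ∫ x, psi1 x with hP₁
  have hP₁0 : 0 < P₁ := integral_psi1_pos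
  set P₁' : ℝ := max P₁ 1 with hP₁'
  have hP₁'1 : 1 ≤ P₁' := le_max_right _ _
  have hP₁le : P₁ ≤ P₁' := le_max_left _ _
  set Mx : ℝ := (2 : ℝ) ^ ib with hMx
  have hMx1 : 1 ≤ Mx := one_le_pow₀ (by norm_num)
  have hMx0 : 0 < Mx := by linarith
  set B : ℝ := (N : ℝ) * Mx / L with hB
  have hB0 : 0 < B := by rw [hB]; positivity
  have hNMx : (N : ℝ) * Mx ≤ 3 * T * L := (mul_le_mul_of_nonneg_left hib hn0.le).trans hNM₀
  -- `B ≥ 48` and `B ≤ T_a`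
  have hBlo : 48 ≤ B := by
    have h1 : (N : ℝ) ^ (1 / 2 : ℝ) ≤ B := by
      rw [hB, le_div_iff₀ hL0]
      calc (N : ℝ) ^ (1 / 2 : ℝ) * L ≤ (N : ℝ) ^ (1 / 2 : ℝ) * (N : ℝ) ^ (1 / 2 : ℝ) := by gcongr
        _ = (N : ℝ) * 1 := by rw [hnp]; norm_num
        _ ≤ (N : ℝ) * Mx := by gcongr
    have h2 : (48 : ℝ) ≤ (N : ℝ) ^ (1 / 2 : ℝ) := by
      have : ((2304 : ℝ)) ^ (1 / 2 : ℝ) ≤ (N : ℝ) ^ (1 / 2 : ℝ) := Real.rpow_le_rpow (by norm_num) hN (by norm_num)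
      rwa [show (2304 : ℝ) = 48 ^ 2 by norm_num, sq_rpow_half (by norm_num)] at this
    linarith
  set T_a : ℝ := 48 * T * L with hT_a
  have hBTa : B ≤ T_a := by
    have : B ≤ (N : ℝ) * Mx := by
      rw [hB, div_le_iff₀ hL0]
      calc (N : ℝ) * Mx = (N : ℝ) * Mx * 1 := (mul_one _).symm
        _ ≤ (N : ℝ) * Mx * L := by gcongr
    linarith
  have hTaN : (N : ℝ) ≤ T_a := by
    have : T * L ≥ N * 1 := mul_le_mul hNT hL1 zero_le_one hT0.le
    linarith
  have hTaT₉ : T₉ ≤ T_a := hNT₉.trans hTaN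
  have hCFTa : C_F ≤ P₁ * T_a ^ 2 := by
    refine hNCF.trans (mul_le_mul_of_nonneg_left ?_ hP₁0.le)
    calc (N : ℝ) ≤ T_a := hTaN
      _ = T_a * 1 := (mul_one _).symm
      _ ≤ T_a * T_a := by gcongr; linarith
      _ = T_a ^ 2 := (sq T_a).symm
  -- the function `f_B` and its class properties
  set f : ℝ → ℝ := fB W B with hf
  have hfc : ContDiff ℝ ∞ f := fB_contDiff W hB0
  have hfs : HasCompactSupport f := hasCompactSupport_fB W hB0
  have hf0 : ∀ x, 0 ≤ f x := fB_nonneg W hB0.le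
  have hfS : ∀ x, f x ≠ 0 → 1 / 16 ≤ x ∧ x ≤ 9 / 2 := fun x hx ↦ fB_support W hBlo hx
  have hfdec : ∀ ζ : ℝ, ζ ≠ 0 → ‖𝓕 (fun y ↦ ((f y : ℝ) : ℂ)) ζ‖ ≤ T_a ^ 2 * (∫ y, f y) * (T_a / |ζ|) ^ 4 :=
    fun ζ hζ ↦ fB_decay_class hCF W hB0 hBTa hCFTa hζ
  -- moments
  set G1 : ℝ := ∫ u, gW W u with hG1
  set G2 : ℝ := ∫ u, gW W u ^ 2 with hG2
  have hG10 : 0 ≤ G1 := integral_nonneg (gW_nonneg W)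
  have hG20 : 0 ≤ G2 := integral_nonneg fun u ↦ sq_nonneg _
  have hf1 : ∫ y, f y = P₁ * G1 := integral_fB W hB0
  have hf2 : ∫ y, f y ^ 2 ≤ P₁ ^ 2 * G2 := integral_fB_sq_le W hB0
  set ρ : ℝ := L / L ^ j with hρ
  have hρ0 : 0 ≤ ρ := by rw [hρ]; positivity
  have hG2E : G2 ≤ C₄ * L * E + C₄ * ρ * K ^ 4 := by
    have := hC₄ W L hL1
    simp only [hρ]
    calc G2 ≤ C₄ * L * E + C₄ * L / L ^ j * K ^ 4 := this
      _ = C₄ * L * E + C₄ * (L / L ^ j) * K ^ 4 := by ring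
  have hρN : ρ * (N : ℝ) ^ 2 ≤ 1 := by
    have e1 : ρ = (N : ℝ) ^ (η - η * j) := by
      rw [hρ, hL, ← Real.rpow_natCast, ← Real.rpow_mul hn0.le, ← Real.rpow_sub hn0]
    rw [e1, show ((N : ℝ)) ^ 2 = (N : ℝ) ^ (2 : ℝ) by norm_cast, hnp]
    calc (N : ℝ) ^ (η - η * j + 2) ≤ (N : ℝ) ^ (0 : ℝ) := hnle (by nlinarith)
      _ = 1 := Real.rpow_zero _
  -- Proposition 9.1 for the two configurations, with `M = 16 Mx`
  set M : ℝ := 16 * Mx with hM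
  have hM1 : 1 ≤ M := by simp only [hM]; linarith
  have hMTa : M ≤ T_a := by
    have h1 : Mx ≤ 3 * T * L := by
      calc Mx = 1 * Mx := (one_mul _).symm
        _ ≤ (N : ℝ) * Mx := by gcongr
        _ ≤ 3 * T * L := hNMx
    simp only [hM, hT_a]; linarith
  have hshell : ∀ i : ℕ, ∀ m ∈ shell M₀ i, (2 : ℝ) ^ i ≤ |(m : ℝ)| ∧ |(m : ℝ)| ≤ 2 * 2 ^ i :=
    fun i m hm ↦ shell_bounds hm
  have hpow_le : ∀ {a b : ℕ}, a ≤ b → (2 : ℝ) ^ a ≤ 2 ^ b := fun h ↦ pow_le_pow_right₀ (by norm_num) h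
  have hia_M : (2 : ℝ) ^ ia ≤ M := by
    calc (2 : ℝ) ^ ia ≤ 2 ^ ib := hpow_le hia
      _ = 1 * Mx := by rw [one_mul]
      _ ≤ 16 * Mx := by gcongr; norm_num
  have hib_M : (2 : ℝ) ^ ib ≤ M := by
    calc (2 : ℝ) ^ ib = 1 * Mx := by rw [one_mul]
      _ ≤ 16 * Mx := by gcongr; norm_num
  have hi₃_M : (2 : ℝ) ^ i₃ ≤ M := by
    calc (2 : ℝ) ^ i₃ ≤ 2 ^ (ib + 4) := hpow_le hi₃
      _ = 16 * Mx := by rw [pow_add]; ring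
  have htop₃ : (((2 ^ (i₃ + 1) : ℕ)) : ℝ) ≤ 23 * M := by
    push_cast
    calc (2 : ℝ) ^ (i₃ + 1) ≤ 2 ^ (ib + 5) := hpow_le (by omega)
      _ = 32 * Mx := by rw [pow_add]; ring
      _ ≤ 23 * (16 * Mx) := by nlinarith
  have htop₁ : (((2 ^ (ia + 1) : ℕ)) : ℝ) ≤ 23 * M := by
    push_cast
    calc (2 : ℝ) ^ (ia + 1) ≤ 2 ^ (ib + 1) := hpow_le (by omega)
      _ = 2 * Mx := by rw [pow_succ]; ring
      _ ≤ 23 * (16 * Mx) := by nlinarith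
  have hone : ∀ i : ℕ, (1 : ℝ) ≤ 2 ^ i := fun i ↦ one_le_pow₀ (by norm_num)
  have hJ₂ := hC₉ T_a hTaT₉ M hM1 hMTa f hfc hfs hf0 hfS hfdec (shell M₀ ia) (shell M₀ ib) (2 ^ ia) (2 ^ ib)
    (2 ^ (i₃ + 1)) (hone ia) hia_M (hone ib) hib_M htop₃ (hshell ia) (hshell ib)
  have hJ₁ := hC₉ T_a hTaT₉ M hM1 hMTa f hfc hfs hf0 hfS hfdec (shell M₀ i₃) (shell M₀ ib) (2 ^ i₃) (2 ^ ib)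
    (2 ^ (ia + 1)) (hone i₃) hi₃_M (hone ib) hib_M htop₁ (hshell i₃) (hshell ib)
  -- `Θ = T_a^η`, `Θ^{1/2} ≤ 7L`
  set Θ : ℝ := T_a ^ η with hΘ
  have hTa0 : 0 ≤ T_a := by rw [hT_a]; positivity
  have hΘ0 : 0 ≤ Θ := by rw [hΘ]; positivity
  have hL4 : L ^ 4 = (N : ℝ) ^ (4 * η) := by
    rw [hL, ← Real.rpow_natCast, ← Real.rpow_mul hn0.le]; congr 1; push_cast; ring
  have hL4_1 : 1 ≤ L ^ 4 := one_le_pow₀ hL1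
  have hΘhalf : Θ ^ (1 / 2 : ℝ) ≤ 7 * L ^ 4 := by
    -- `T_a ≤ 48 N⁶ N^{1/2}`, so `Θ^{1/2} = T_a^{η/2} ≤ (48N^{13/2})^{η/2} ≤ 48^{1/4} N^{4η} ≤ 7L⁴`
    have hTa_le : T_a ≤ 48 * (N : ℝ) ^ (13 / 2 : ℝ) := by
      simp only [hT_a]
      have h1 : T * L ≤ (N : ℝ) ^ (6 : ℝ) * (N : ℝ) ^ (1 / 2 : ℝ) := mul_le_mul hT6 hLhalf hL0.le (by positivity)
      rw [hnp] at h1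
      have h2 : (N : ℝ) ^ ((6 : ℝ) + 1 / 2) = (N : ℝ) ^ (13 / 2 : ℝ) := by norm_num
      rw [h2] at h1
      linarith
    have eη1 : η * (1 / 2) = η / 2 := by ring
    have eη2 : (13 / 2 : ℝ) * (η / 2) = 13 * η / 4 := by ring
    calc Θ ^ (1 / 2 : ℝ) = T_a ^ (η / 2) := by rw [hΘ, ← Real.rpow_mul hTa0, eη1]
      _ ≤ (48 * (N : ℝ) ^ (13 / 2 : ℝ)) ^ (η / 2) := Real.rpow_le_rpow hTa0 hTa_le (by positivity)
      _ = (48 : ℝ) ^ (η / 2) * (N : ℝ) ^ (13 * η / 4) := by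
          rw [Real.mul_rpow (by norm_num) (by positivity), ← Real.rpow_mul hn0.le, eη2]
      _ ≤ 7 * L ^ 4 := by
          rw [hL4]
          refine mul_le_mul ?_ (hnle (by linarith)) (by positivity) (by norm_num)
          calc (48 : ℝ) ^ (η / 2) ≤ (48 : ℝ) ^ (1 / 4 : ℝ) := Real.rpow_le_rpow_of_exponent_le (by norm_num) (by linarith)
            _ ≤ ((7 : ℝ) ^ (4 : ℕ)) ^ (1 / 4 : ℝ) := Real.rpow_le_rpow (by norm_num) (by norm_num) (by norm_num)
            _ = 7 := by rw [← Real.rpow_natCast, ← Real.rpow_mul (by norm_num)]; norm_num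
  -- the `Z`-form of the two `J` bounds
  set Z : ℝ := (16 * Mx) ^ 6 * (P₁' * G1) ^ 2 + (16 * Mx) ^ 4 * (P₁' ^ 2 * G2) with hZ
  have hZJ : C₉ * T_a ^ η * (M ^ 6 * (∫ y, f y) ^ 2 + M ^ 4 * ∫ y, f y ^ 2) ≤ C₉ * Θ * Z := by
    simp only [hΘ, hZ, hM]
    refine mul_le_mul_of_nonneg_left ?_ (by positivity)
    rw [hf1]
    have h1 : (P₁ * G1) ^ 2 ≤ (P₁' * G1) ^ 2 := by gcongr
    have h2 : ∫ y, f y ^ 2 ≤ P₁' ^ 2 * G2 := hf2.trans (by gcongr)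
    gcongr
  have hJ₁b := hJ₁.trans hZJ
  have hJ₂b := hJ₂.trans hZJ
  have hJ₁0 : 0 ≤ Jfun f (shell M₀ i₃) (shell M₀ ib) (2 ^ (ia + 1)) := integral_nonneg fun u ↦ sq_nonneg _
  have hJ₂0 : 0 ≤ Jfun f (shell M₀ ia) (shell M₀ ib) (2 ^ (i₃ + 1)) := integral_nonneg fun u ↦ sq_nonneg _
  -- `N³/B = N²L/Mx ≤ N²L⁴/Mx`
  have hNB : (N : ℝ) ^ 3 / B = (N : ℝ) ^ 2 * L / Mx := by
    rw [hB]
    field_simp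
  rw [hNB]
  have hLL4 : L ≤ L ^ 4 := le_self_pow₀ hL1 (by norm_num)
  have hNMx4 : (N : ℝ) * Mx ≤ 3 * T * L ^ 4 := hNMx.trans (by gcongr)
  have hG2E4 : G2 ≤ C₄ * L ^ 4 * E + C₄ * ρ * K ^ 4 := by
    have hC₄0 : 0 ≤ C₄ := by linarith
    have : C₄ * L * E ≤ C₄ * L ^ 4 * E := by gcongr
    linarith
  have hX0 : 0 ≤ G1 ^ (1 / 2 : ℝ) * (4 * Jfun f (shell M₀ i₃) (shell M₀ ib) (2 ^ (ia + 1))) ^ (1 / 4 : ℝ) *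
      (Jfun f (shell M₀ ia) (shell M₀ ib) (2 ^ (i₃ + 1))) ^ (1 / 4 : ℝ) := by positivity
  have hmono : C_b * ((N : ℝ) ^ 2 * L / Mx) * (G1 ^ (1 / 2 : ℝ) *
        (4 * Jfun f (shell M₀ i₃) (shell M₀ ib) (2 ^ (ia + 1))) ^ (1 / 4 : ℝ) *
        (Jfun f (shell M₀ ia) (shell M₀ ib) (2 ^ (i₃ + 1))) ^ (1 / 4 : ℝ)) ≤
      C_b * ((N : ℝ) ^ 2 * L ^ 4 / Mx) * (G1 ^ (1 / 2 : ℝ) *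
        (4 * Jfun f (shell M₀ i₃) (shell M₀ ib) (2 ^ (ia + 1))) ^ (1 / 4 : ℝ) *
        (Jfun f (shell M₀ ia) (shell M₀ ib) (2 ^ (i₃ + 1))) ^ (1 / 4 : ℝ)) := by
    gcongr
  refine hmono.trans ?_
  have h := main_block_alg (C_b := C_b) (L := L ^ 4) hK0 hKT hE0 hT1 hn1 hL4_1 hMx1 hNMx4 hG10 hC₂W hG20 hρ0 hρN
    hG2E4 hC_b0 hC₂1 hC₄1 hC₉1 hP₁'1 hΘ0 hΘhalf hJ₁0 hJ₂0 hJ₁b hJ₂b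
  have e16 : (L ^ 4) ^ 4 = L ^ 16 := by rw [← pow_mul]
  rw [e16] at h
  exact h


set_option maxHeartbeats 3200000 in
/-- **One dyadic block, `T` free** (the tree's `GuthMaynardS3Final.block_bound` is the case `T = N^{6/5}`): for a block
`shell i₁ × shell i₂ × shell i₃` of `𝓜³` with `2^{i₁}, 2^{i₂} ≤ M₀`, either `i₃ ≥ max(i₁,i₂) + 5` and every
`|I_m|` is negligible (`|θ| ≥ N` on the box), or the block is localised in the larger of `|m₁|, |m₂|`
(Proposition 7.2) and bounded through Proposition 9.1 for `f_B` (`main_block`):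
`∑_{m ∈ block} |I_m| ≤ A₁ N^{16η} 𝒯 + |block| · C_n N³|W|³N^{-ηj}`, `𝒯 = T²|W|^{3/2} + TN|W|^{1/2}E(W)^{1/2}`
(`N ≤ T ≤ N⁶`, `W ⊂ [t₀, t₀+T]` `1`-separated, `NM₀ ≤ 3TN^η`).
[cite: GuthMaynard2026, proof of Proposition 10.1] -/
theorem block_bound_freeT {w : ℝ → ℝ} (hw : ContDiff ℝ ∞ w) (hsupp : Function.support w ⊆ Set.Icc 1 2)
    {η : ℝ} (hη0 : 0 < η) (hη12 : η ≤ 1 / 2) (j : ℕ) (hηj2 : 2 ≤ η * ((j : ℝ) - 1)) :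
    ∃ A₁ Cn N₀ : ℝ, 0 ≤ A₁ ∧ 0 ≤ Cn ∧ ∀ (N : ℕ), N₀ ≤ (N : ℝ) → ∀ (T : ℝ), (N : ℝ) ≤ T → T ≤ (N : ℝ) ^ (6 : ℝ) →
      ∀ (t₀ : ℝ) (W : Finset ℝ),
      (∀ t ∈ W, t₀ ≤ t ∧ t ≤ t₀ + T) →
      (∀ t ∈ W, ∀ t' ∈ W, t ≠ t' → 1 ≤ |t - t'|) →
      ∀ (M₀ : ℕ), (N : ℝ) * M₀ ≤ 3 * T * (N : ℝ) ^ η →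
      ∀ (i₁ i₂ i₃ : ℕ), (2 : ℝ) ^ i₁ ≤ M₀ → (2 : ℝ) ^ i₂ ≤ M₀ →
      ∑ m ∈ shell M₀ i₁ ×ˢ (shell M₀ i₂ ×ˢ shell M₀ i₃), ‖Im w N W m‖ ≤
        A₁ * ((N : ℝ) ^ η) ^ 16 * (T ^ 2 * (W.card : ℝ) ^ (3 / 2 : ℝ) +
          T * N * (W.card : ℝ) ^ (1 / 2 : ℝ) * (addEnergy W) ^ (1 / 2 : ℝ)) +
        ((shell M₀ i₁ ×ˢ (shell M₀ i₂ ×ˢ shell M₀ i₃)).card : ℝ) *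
          (Cn * ((N : ℝ) ^ 3 * (W.card : ℝ) ^ 3 * (N : ℝ) ^ (-(η * j)))) := by
  have hη1 : η ≤ 1 := by linarith
  set P₁ : ℝ := ∫ x, psi1 x
  have hP₁0 : 0 < P₁ := integral_psi1_pos
  -- constants
  obtain ⟨C_b, hC_b0, hC_b⟩ := block_sum_le_snd hw hsupp hη0 j
  obtain ⟨C_b', -, hC_b'⟩ := block_sum_le_fst hw hsupp hη0 j
  obtain ⟨D, hD0, hD⟩ := norm_Im_le_majorant hw hsupp j
  obtain ⟨C₂, -, hC₂⟩ := integral_gW_le_card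
  obtain ⟨C₄, -, hC₄⟩ := integral_gW_sq_le_energy j
  obtain ⟨C_F, -, hC_F⟩ := norm_fourier_fB_le_decay 4
  obtain ⟨C₉, T₉, -, hC₉⟩ := affine_equidistribution hη0 hη1
  -- constants made `≥ 1`
  obtain ⟨C₂', hC₂'⟩ : ∃ C : ℝ, C = max C₂ 1 := ⟨_, rfl⟩
  obtain ⟨C₄', hC₄'⟩ : ∃ C : ℝ, C = max C₄ 1 := ⟨_, rfl⟩
  obtain ⟨C₉', hC₉'⟩ : ∃ C : ℝ, C = max C₉ 1 := ⟨_, rfl⟩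
  have hC₂'1 : 1 ≤ C₂' := by rw [hC₂']; exact le_max_right _ _
  have hC₄'1 : 1 ≤ C₄' := by rw [hC₄']; exact le_max_right _ _
  have hC₉'1 : 1 ≤ C₉' := by rw [hC₉']; exact le_max_right _ _
  have hC₂le : C₂ ≤ C₂' := by rw [hC₂']; exact le_max_left _ _
  have hC₄le : C₄ ≤ C₄' := by rw [hC₄']; exact le_max_left _ _
  have hC₉le : C₉ ≤ C₉' := by rw [hC₉']; exact le_max_left _ _
  obtain ⟨Cmb, hCmb⟩ : ∃ C : ℝ, C = max C_b C_b' := ⟨_, rfl⟩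
  have hCb_le : C_b ≤ Cmb := by rw [hCmb]; exact le_max_left _ _
  have hCb'_le : C_b' ≤ Cmb := by rw [hCmb]; exact le_max_right _ _
  have hCmb0 : 0 ≤ Cmb := hC_b0.trans hCb_le
  set A₁ : ℝ := 10 ^ 6 * Cmb * C₂' ^ 2 * C₉' * (max P₁ 1) * C₄' with hA₁
  have hA₁0 : 0 ≤ A₁ := by rw [hA₁]; positivity
  refine ⟨A₁, 9 / 4 * D + Cmb, max (max 2304 T₉) (max (C_F / P₁) 2), hA₁0, by positivity, ?_⟩
  intro N hN T hNT hT6 t₀ W hW hsep1 M₀ hNM₀ i₁ i₂ i₃ hi₁ hi₂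
  -- thresholds
  have hN2304 : (2304 : ℝ) ≤ N := le_trans (le_trans (le_max_left _ _) (le_max_left _ _)) hN
  have hNT₉ : T₉ ≤ N := le_trans (le_trans (le_max_right _ _) (le_max_left _ _)) hN
  have hNCF : C_F / P₁ ≤ N := le_trans (le_trans (le_max_left _ _) (le_max_right _ _)) hN
  have hNCF' : C_F ≤ P₁ * N := by rwa [div_le_iff₀' hP₁0] at hNCF
  have hn1 : (1 : ℝ) ≤ N := by linarith
  have hn0 : (0 : ℝ) < N := by linarith
  have hNnat : 1 ≤ N := by exact_mod_cast hn1
  have hT1 : 1 ≤ T := hn1.trans hNT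
  have hKT : (W.card : ℝ) ≤ 2 * T := by
    have h := SeparatedSums.card_le_of_sep one_pos (by linarith) W hW hsep1
    rw [div_one] at h
    linarith
  have hLN : (N : ℝ) ^ η ≤ N := by
    calc (N : ℝ) ^ η ≤ (N : ℝ) ^ (1 : ℝ) := Real.rpow_le_rpow_of_exponent_le hn1 hη1
      _ = N := Real.rpow_one _
  -- the constants' defining properties, with the enlarged constants
  have hC₂'' : ∫ u, gW W u ≤ C₂' * W.card :=
    (hC₂ W hsep1).trans (mul_le_mul_of_nonneg_right hC₂le (Nat.cast_nonneg _))
  have hC₄'' : ∀ (W' : Finset ℝ) (D' : ℝ), 1 ≤ D' →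
      ∫ u, gW W' u ^ 2 ≤ C₄' * D' * addEnergy W' + C₄' * D' / D' ^ j * (W'.card : ℝ) ^ 4 := by
    intro W' D' hD'
    have h0 : ∫ u, gW W' u ^ 2 ≤ C₄ * D' * addEnergy W' + C₄ * D' / D' ^ j * (W'.card : ℝ) ^ 4 := hC₄ W' D' hD'
    have hE' := addEnergy_nonneg W'
    have hD0 : 0 ≤ D' := by linarith
    have t1 : C₄ * D' * addEnergy W' ≤ C₄' * D' * addEnergy W' :=
      mul_le_mul_of_nonneg_right (mul_le_mul_of_nonneg_right hC₄le hD0) hE'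
    have t2 : C₄ * D' / D' ^ j * (W'.card : ℝ) ^ 4 ≤ C₄' * D' / D' ^ j * (W'.card : ℝ) ^ 4 :=
      mul_le_mul_of_nonneg_right (div_le_div_of_nonneg_right (mul_le_mul_of_nonneg_right hC₄le hD0) (by positivity))
        (by positivity)
    linarith
  have hNT₉' : max T₉ 0 ≤ (N : ℝ) := max_le hNT₉ hn0.le
  have hC₉'' : ∀ T' : ℝ, max T₉ 0 ≤ T' → ∀ M : ℝ, 1 ≤ M → M ≤ T' →
      ∀ f : ℝ → ℝ, ContDiff ℝ ∞ f → HasCompactSupport f → (∀ x, 0 ≤ f x) →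
      (∀ x, f x ≠ 0 → 1 / 16 ≤ x ∧ x ≤ 9 / 2) →
      (∀ ζ : ℝ, ζ ≠ 0 → ‖𝓕 (fun y ↦ ((f y : ℝ) : ℂ)) ζ‖ ≤ T' ^ 2 * (∫ y, f y) * (T' / |ζ|) ^ 4) →
      ∀ (I₁ I₂ : Finset ℤ) (M₁ M₂ : ℝ) (M₃ : ℕ), 1 ≤ M₁ → M₁ ≤ M → 1 ≤ M₂ → M₂ ≤ M → (M₃ : ℝ) ≤ 23 * M →
      (∀ m ∈ I₁, M₁ ≤ |(m : ℝ)| ∧ |(m : ℝ)| ≤ 2 * M₁) → (∀ m ∈ I₂, M₂ ≤ |(m : ℝ)| ∧ |(m : ℝ)| ≤ 2 * M₂) →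
      Jfun f I₁ I₂ M₃ ≤ C₉' * T' ^ η * (M ^ 6 * (∫ y, f y) ^ 2 + M ^ 4 * ∫ y, f y ^ 2) := by
    intro T' hT' M hM hMT f hfc hfs hf0 hfS hfd I₁ I₂ M₁ M₂ M₃ h1 h2 h3 h4 h5 h6 h7
    have hT'0 : 0 ≤ T' := le_trans (le_max_right _ _) hT'
    refine (hC₉ T' (le_trans (le_max_left _ _) hT') M hM hMT f hfc hfs hf0 hfS hfd I₁ I₂ M₁ M₂ M₃
      h1 h2 h3 h4 h5 h6 h7).trans ?_
    have : 0 ≤ ∫ y, f y ^ 2 := integral_nonneg fun y ↦ sq_nonneg _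
    exact mul_le_mul_of_nonneg_right (mul_le_mul_of_nonneg_right hC₉le (by positivity)) (by positivity)
  clear hC₉ hC₄ hC₂
  -- the two block estimates, specialised
  have hblk₂ := hC_b N hNnat W M₀ i₁ i₂ i₃
  have hblk₁ := hC_b' N hNnat W M₀ i₁ i₂ i₃
  clear hC_b hC_b'
  -- abbreviations
  have hK0 : 0 ≤ (W.card : ℝ) := Nat.cast_nonneg _
  have hE0 : 0 ≤ addEnergy W := addEnergy_nonneg W
  set 𝒯 : ℝ := T ^ 2 * (W.card : ℝ) ^ (3 / 2 : ℝ) +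
    T * N * (W.card : ℝ) ^ (1 / 2 : ℝ) * (addEnergy W) ^ (1 / 2 : ℝ) with h𝒯
  have h𝒯0 : 0 ≤ 𝒯 := by rw [h𝒯]; positivity
  set negl : ℝ := (9 / 4 * D + Cmb) * ((N : ℝ) ^ 3 * (W.card : ℝ) ^ 3 * (N : ℝ) ^ (-(η * j))) with hnegl
  have hnegl0 : 0 ≤ negl := by rw [hnegl]; positivity
  have hALT : 0 ≤ A₁ * ((N : ℝ) ^ η) ^ 16 * 𝒯 := by positivity
  set S := shell M₀ i₁ ×ˢ (shell M₀ i₂ ×ˢ shell M₀ i₃)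
  by_cases hfar : max i₁ i₂ + 5 ≤ i₃
  · -- negligible block
    have hterm : ∀ m ∈ S, ‖Im w N W m‖ ≤ negl := by
      intro m hm
      refine (hD N W m).trans ((majorant_le_of_far_block hD0 j N W hfar hm).trans ?_)
      have h1 : D / (1 + (N : ℝ)) ^ j ≤ D * (N : ℝ) ^ (-(η * j)) := by
        rw [div_eq_mul_inv]
        refine mul_le_mul_of_nonneg_left ?_ hD0
        rw [Real.rpow_neg hn0.le]
        refine inv_anti₀ (by positivity) ?_
        calc (N : ℝ) ^ (η * j) = ((N : ℝ) ^ η) ^ j := by rw [Real.rpow_mul hn0.le, Real.rpow_natCast]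
          _ ≤ (1 + (N : ℝ)) ^ j := pow_le_pow_left₀ (by positivity) (by linarith [hLN]) j
      calc (N : ℝ) ^ 3 * (9 / 4 * (W.card : ℝ) ^ 3 * (D / (1 + (N : ℝ)) ^ j))
          ≤ (N : ℝ) ^ 3 * (9 / 4 * (W.card : ℝ) ^ 3 * (D * (N : ℝ) ^ (-(η * j)))) := by gcongr
        _ = (9 / 4 * D) * ((N : ℝ) ^ 3 * (W.card : ℝ) ^ 3 * (N : ℝ) ^ (-(η * j))) := by ring
        _ ≤ (9 / 4 * D + Cmb) * ((N : ℝ) ^ 3 * (W.card : ℝ) ^ 3 * (N : ℝ) ^ (-(η * j))) := by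
            gcongr; linarith
    calc ∑ m ∈ S, ‖Im w N W m‖ ≤ ∑ m ∈ S, negl := Finset.sum_le_sum hterm
      _ = (S.card : ℝ) * negl := by rw [Finset.sum_const, nsmul_eq_mul]
      _ ≤ A₁ * ((N : ℝ) ^ η) ^ 16 * 𝒯 + (S.card : ℝ) * negl := by linarith
  · rw [not_le] at hfar
    rcases le_or_gt i₁ i₂ with h12 | h12
    · -- localise in `v₂`: `|m₂| ≥ 2^{i₂}`
      have hmain := main_block_freeT (C_b := Cmb) (ia := i₁) (ib := i₂) (i₃ := i₃) hη0 hη12 hC₉'1 hC₉'' hC_F hC₂'1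
        hC₄'1 hηj2 hC₄'' hCmb0 hN2304 hNT₉' hNCF' hNT hT6 W hC₂'' hKT hNM₀ h12 (by omega) hi₂
      have hX0 : 0 ≤ (∫ u, gW W u) ^ (1 / 2 : ℝ) *
          (4 * Jfun (fB W ((N : ℝ) * 2 ^ i₂ / (N : ℝ) ^ η)) (shell M₀ i₃) (shell M₀ i₂) (2 ^ (i₁ + 1))) ^ (1 / 4 : ℝ) *
          (Jfun (fB W ((N : ℝ) * 2 ^ i₂ / (N : ℝ) ^ η)) (shell M₀ i₁) (shell M₀ i₂) (2 ^ (i₃ + 1))) ^ (1 / 4 : ℝ) :=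
        mul_nonneg (mul_nonneg (Real.rpow_nonneg (integral_nonneg (gW_nonneg W)) _)
          (Real.rpow_nonneg (mul_nonneg (by norm_num) (integral_nonneg fun u ↦ sq_nonneg _)) _))
          (Real.rpow_nonneg (integral_nonneg fun u ↦ sq_nonneg _) _)
      have hQ0 : 0 ≤ (N : ℝ) ^ 3 / ((N : ℝ) * 2 ^ i₂ / (N : ℝ) ^ η) := by positivity
      set X : ℝ := (∫ u, gW W u) ^ (1 / 2 : ℝ) *
          (4 * Jfun (fB W ((N : ℝ) * 2 ^ i₂ / (N : ℝ) ^ η)) (shell M₀ i₃) (shell M₀ i₂) (2 ^ (i₁ + 1))) ^ (1 / 4 : ℝ) *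
          (Jfun (fB W ((N : ℝ) * 2 ^ i₂ / (N : ℝ) ^ η)) (shell M₀ i₁) (shell M₀ i₂) (2 ^ (i₃ + 1))) ^ (1 / 4 : ℝ)
      set Q : ℝ := (N : ℝ) ^ 3 / ((N : ℝ) * 2 ^ i₂ / (N : ℝ) ^ η)
      have hmain' : Cmb * Q * X ≤ A₁ * ((N : ℝ) ^ η) ^ 16 * 𝒯 := hmain
      have hblk' : ∑ m ∈ S, ‖Im w N W m‖ ≤ C_b * Q * X +
          C_b * (S.card : ℝ) * ((N : ℝ) ^ 3 * (W.card : ℝ) ^ 3 * (N : ℝ) ^ (-(η * j))) := hblk₂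
      have hCb1 : C_b * Q * X ≤ Cmb * Q * X :=
        mul_le_mul_of_nonneg_right (mul_le_mul_of_nonneg_right hCb_le hQ0) hX0
      have hCb2 : C_b * (S.card : ℝ) * ((N : ℝ) ^ 3 * (W.card : ℝ) ^ 3 * (N : ℝ) ^ (-(η * j))) ≤
          (S.card : ℝ) * negl := by
        have h1 : C_b ≤ 9 / 4 * D + Cmb := by linarith
        calc C_b * (S.card : ℝ) * ((N : ℝ) ^ 3 * (W.card : ℝ) ^ 3 * (N : ℝ) ^ (-(η * j)))
            = (S.card : ℝ) * (C_b * ((N : ℝ) ^ 3 * (W.card : ℝ) ^ 3 * (N : ℝ) ^ (-(η * j)))) := by ring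
          _ ≤ (S.card : ℝ) * ((9 / 4 * D + Cmb) * ((N : ℝ) ^ 3 * (W.card : ℝ) ^ 3 * (N : ℝ) ^ (-(η * j)))) :=
              mul_le_mul_of_nonneg_left (mul_le_mul_of_nonneg_right h1 (by positivity)) (Nat.cast_nonneg _)
      linarith only [hblk', hmain', hCb1, hCb2]
    · -- localise in `v₁`: `|m₁| ≥ 2^{i₁}`
      have hmain := main_block_freeT (C_b := Cmb) (ia := i₂) (ib := i₁) (i₃ := i₃) hη0 hη12 hC₉'1 hC₉'' hC_F hC₂'1
        hC₄'1 hηj2 hC₄'' hCmb0 hN2304 hNT₉' hNCF' hNT hT6 W hC₂'' hKT hNM₀ h12.le (by omega) hi₁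
      have hX0 : 0 ≤ (∫ u, gW W u) ^ (1 / 2 : ℝ) *
          (4 * Jfun (fB W ((N : ℝ) * 2 ^ i₁ / (N : ℝ) ^ η)) (shell M₀ i₃) (shell M₀ i₁) (2 ^ (i₂ + 1))) ^ (1 / 4 : ℝ) *
          (Jfun (fB W ((N : ℝ) * 2 ^ i₁ / (N : ℝ) ^ η)) (shell M₀ i₂) (shell M₀ i₁) (2 ^ (i₃ + 1))) ^ (1 / 4 : ℝ) :=
        mul_nonneg (mul_nonneg (Real.rpow_nonneg (integral_nonneg (gW_nonneg W)) _)
          (Real.rpow_nonneg (mul_nonneg (by norm_num) (integral_nonneg fun u ↦ sq_nonneg _)) _))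
          (Real.rpow_nonneg (integral_nonneg fun u ↦ sq_nonneg _) _)
      have hQ0 : 0 ≤ (N : ℝ) ^ 3 / ((N : ℝ) * 2 ^ i₁ / (N : ℝ) ^ η) := by positivity
      set X : ℝ := (∫ u, gW W u) ^ (1 / 2 : ℝ) *
          (4 * Jfun (fB W ((N : ℝ) * 2 ^ i₁ / (N : ℝ) ^ η)) (shell M₀ i₃) (shell M₀ i₁) (2 ^ (i₂ + 1))) ^ (1 / 4 : ℝ) *
          (Jfun (fB W ((N : ℝ) * 2 ^ i₁ / (N : ℝ) ^ η)) (shell M₀ i₂) (shell M₀ i₁) (2 ^ (i₃ + 1))) ^ (1 / 4 : ℝ)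
      set Q : ℝ := (N : ℝ) ^ 3 / ((N : ℝ) * 2 ^ i₁ / (N : ℝ) ^ η)
      have hmain' : Cmb * Q * X ≤ A₁ * ((N : ℝ) ^ η) ^ 16 * 𝒯 := hmain
      have hblk' : ∑ m ∈ S, ‖Im w N W m‖ ≤ C_b' * Q * X +
          C_b' * (S.card : ℝ) * ((N : ℝ) ^ 3 * (W.card : ℝ) ^ 3 * (N : ℝ) ^ (-(η * j))) := hblk₁
      have hCb1 : C_b' * Q * X ≤ Cmb * Q * X :=
        mul_le_mul_of_nonneg_right (mul_le_mul_of_nonneg_right hCb'_le hQ0) hX0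
      have hCb2 : C_b' * (S.card : ℝ) * ((N : ℝ) ^ 3 * (W.card : ℝ) ^ 3 * (N : ℝ) ^ (-(η * j))) ≤
          (S.card : ℝ) * negl := by
        have h1 : C_b' ≤ 9 / 4 * D + Cmb := by linarith
        calc C_b' * (S.card : ℝ) * ((N : ℝ) ^ 3 * (W.card : ℝ) ^ 3 * (N : ℝ) ^ (-(η * j)))
            = (S.card : ℝ) * (C_b' * ((N : ℝ) ^ 3 * (W.card : ℝ) ^ 3 * (N : ℝ) ^ (-(η * j)))) := by ring
          _ ≤ (S.card : ℝ) * ((9 / 4 * D + Cmb) * ((N : ℝ) ^ 3 * (W.card : ℝ) ^ 3 * (N : ℝ) ^ (-(η * j)))) :=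
              mul_le_mul_of_nonneg_left (mul_le_mul_of_nonneg_right h1 (by positivity)) (Nat.cast_nonneg _)
      linarith only [hblk', hmain', hCb1, hCb2]


set_option maxHeartbeats 1600000 in
/-- **Proposition 10.1 in the range `N ≤ T ≤ N⁶`** (with `N^δ`-losses): for every `δ > 0` there are
`C, N₀` such that `|S₃| ≤ C N^δ · (T²|W|^{3/2} + TN|W|^{1/2}E(W)^{1/2})` whenever `N₀ ≤ N ≤ T ≤ N⁶` and
`W ⊂ [t₀, t₀+T]` is `1`-separated. Proof = the tree's proof of `GuthMaynardS3Final.S3_bound` re-run with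
`T` free: `η = min(1/2, δ/34)`, `j = ⌈40/η⌉ + 1`, `M₀ = ⌈(1+T)N^{η−1}⌉`; truncation (7.2)
(`GuthMaynardSimpleS3.trunc_total_freeT`), the `O(N^{18η})` dyadic blocks of Proposition 7.2 each bounded by
`block_bound_freeT` (Proposition 9.1, Lemmas 8.2–8.4), and the negligible total
`|𝓜³| N³|W|³N^{-ηj} ≪ T²|W|^{3/2}`. [cite: GuthMaynard2026, proof of Proposition 10.1] -/
theorem S3_bound_of_le_pow_six {w : ℝ → ℝ} (hw : ContDiff ℝ ∞ w) (hsupp : Function.support w ⊆ Set.Icc 1 2)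
    (δ : ℝ) (hδ : 0 < δ) :
    ∃ C N₀ : ℝ, 0 ≤ C ∧ ∀ N : ℕ, N₀ ≤ (N : ℝ) → ∀ T : ℝ, (N : ℝ) ≤ T → T ≤ (N : ℝ) ^ (6 : ℝ) →
      ∀ (t₀ : ℝ) (W : Finset ℝ),
      (∀ t ∈ W, t₀ ≤ t ∧ t ≤ t₀ + T) →
      (∀ t ∈ W, ∀ t' ∈ W, t ≠ t' → 1 ≤ |t - t'|) →
      ‖S3 w N W‖ ≤ C * (N : ℝ) ^ δ *
        (T ^ 2 * (W.card : ℝ) ^ (3 / 2 : ℝ) + T * N * (W.card : ℝ) ^ (1 / 2 : ℝ) * (addEnergy W) ^ (1 / 2 : ℝ)) := by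
  -- exponents
  obtain ⟨η, hη⟩ : ∃ η : ℝ, η = min (1 / 2) (δ / 34) := ⟨_, rfl⟩
  have hη0 : 0 < η := by rw [hη]; exact lt_min (by norm_num) (by positivity)
  have hη12 : η ≤ 1 / 2 := by rw [hη]; exact min_le_left _ _
  have hη1 : η ≤ 1 := by linarith
  have hηδ : 34 * η ≤ δ := by have := min_le_right (1 / 2 : ℝ) (δ / 34); rw [← hη] at this; linarith
  obtain ⟨j, hj⟩ : ∃ j : ℕ, j = ⌈40 / η⌉₊ + 1 := ⟨_, rfl⟩
  have hj2 : 2 ≤ j := by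
    have : 1 ≤ ⌈40 / η⌉₊ := Nat.one_le_iff_ne_zero.mpr (Nat.ceil_pos.mpr (by positivity)).ne'
    omega
  have hηj1 : 40 ≤ η * ((j : ℝ) - 1) := by
    have h1 : ((j : ℝ) - 1) = (⌈40 / η⌉₊ : ℝ) := by rw [hj]; push_cast; ring
    have h2 : 40 / η ≤ (⌈40 / η⌉₊ : ℝ) := Nat.le_ceil _
    rw [h1]
    calc (40 : ℝ) = η * (40 / η) := by field_simp
      _ ≤ η * (⌈40 / η⌉₊ : ℝ) := by gcongr
  have hηjA : 1 + 6 * (6 : ℝ) + 6 * η ≤ η * j := by nlinarith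
  have hηjB : 2 ≤ η * ((j : ℝ) - 1) := by linarith
  have hηj18 : 18 + 3 * η ≤ η * j := by nlinarith
  -- constants
  obtain ⟨A₄, hA₄0, hA₄⟩ := trunc_total_freeT hw hsupp (A := 6) hη0 hj2 hηjA
  obtain ⟨A₁, Cn, N₁, hA₁0, hCn0, hblock⟩ := block_bound_freeT hw hsupp hη0 hη12 j hηjB
  set A₂ : ℝ := (1 + 6 / η) ^ 3 * A₁ with hA₂
  set A₃ : ℝ := 27 * 27 * Cn * 4 with hA₃
  have hA₂0 : 0 ≤ A₂ := by rw [hA₂]; positivity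
  have hA₃0 : 0 ≤ A₃ := by rw [hA₃]; positivity
  refine ⟨A₂ + A₃ + A₄, max N₁ 1, by positivity, ?_⟩
  intro N hN T hNT hTA t₀ W hW hsep1
  -- basic quantities
  have hNN₁ : N₁ ≤ N := le_trans (le_max_left _ _) hN
  have hn1 : (1 : ℝ) ≤ N := le_trans (le_max_right _ _) hN
  have hn0 : (0 : ℝ) < N := by linarith
  have hNnat : 1 ≤ N := by exact_mod_cast hn1
  have hnle : ∀ {x y : ℝ}, x ≤ y → (N : ℝ) ^ x ≤ (N : ℝ) ^ y := fun h ↦ Real.rpow_le_rpow_of_exponent_le hn1 h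
  have hnp : ∀ x y : ℝ, (N : ℝ) ^ x * (N : ℝ) ^ y = (N : ℝ) ^ (x + y) := fun x y ↦ (Real.rpow_add hn0 x y).symm
  have hn1le : ∀ {x : ℝ}, 0 ≤ x → 1 ≤ (N : ℝ) ^ x := fun h ↦ Real.one_le_rpow hn1 h
  have hT1 : 1 ≤ T := hn1.trans hNT
  have hT0 : 0 < T := by linarith
  have hK0 : 0 ≤ (W.card : ℝ) := Nat.cast_nonneg _
  have hE0 : 0 ≤ addEnergy W := addEnergy_nonneg W
  have hKE : (W.card : ℝ) ^ 2 ≤ addEnergy W := GuthMaynardEnergyBound.card_sq_le_energy W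
  have hKT : (W.card : ℝ) ≤ 2 * T := by
    have h := SeparatedSums.card_le_of_sep one_pos (by linarith) W hW hsep1
    rw [div_one] at h
    linarith
  set L : ℝ := (N : ℝ) ^ η with hL
  have hL1 : 1 ≤ L := hn1le hη0.le
  have hL0 : 0 < L := by linarith
  have hT6 : T ≤ (N : ℝ) ^ 6 := by
    have := hTA; rwa [show (6 : ℝ) = (6 : ℕ) by norm_num, Real.rpow_natCast] at this
  -- `M₀`
  set M₀ : ℕ := ⌈(1 + T) * (N : ℝ) ^ (η - 1)⌉₊
  have hM₀pos : 0 < (1 + T) * (N : ℝ) ^ (η - 1) := by positivity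
  have hM₀1 : 1 ≤ M₀ := Nat.one_le_iff_ne_zero.mpr (Nat.ceil_pos.mpr hM₀pos).ne'
  have hM₀r : (1 : ℝ) ≤ M₀ := by exact_mod_cast hM₀1
  have hM₀lo : (1 + T) * (N : ℝ) ^ (η - 1) ≤ M₀ := Nat.le_ceil _
  have hM₀hi : (M₀ : ℝ) ≤ (1 + T) * (N : ℝ) ^ (η - 1) + 1 := (Nat.ceil_lt_add_one hM₀pos.le).le
  have hNη1 : (N : ℝ) * (N : ℝ) ^ (η - 1) = L := by
    rw [hL, show (N : ℝ) * (N : ℝ) ^ (η - 1) = (N : ℝ) ^ (1 : ℝ) * (N : ℝ) ^ (η - 1) by rw [Real.rpow_one], hnp]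
    ring_nf
  have hNM₀ : (N : ℝ) * M₀ ≤ 3 * T * L := by
    calc (N : ℝ) * M₀ ≤ (N : ℝ) * ((1 + T) * (N : ℝ) ^ (η - 1) + 1) := by gcongr
      _ = (1 + T) * ((N : ℝ) * (N : ℝ) ^ (η - 1)) + N := by ring
      _ = (1 + T) * L + N := by rw [hNη1]
      _ ≤ (T + T) * L + T * L := by
          gcongr
          calc (N : ℝ) = N * 1 := (mul_one _).symm
            _ ≤ T * L := by gcongr
      _ = 3 * T * L := by ring
  have hNM₀' : (1 + T) * L ≤ (N : ℝ) * M₀ := by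
    calc (1 + T) * L = (N : ℝ) * ((1 + T) * (N : ℝ) ^ (η - 1)) := by rw [← hNη1]; ring
      _ ≤ (N : ℝ) * M₀ := by gcongr
  have hN3r : (((N ^ 3 : ℕ)) : ℝ) = (N : ℝ) ^ 3 := by push_cast; ring
  have hn1' : (1 : ℝ) ≤ ((N ^ 3 : ℕ) : ℝ) := by rw [hN3r]; exact one_le_pow₀ hn1
  have hM₀T : (M₀ : ℝ) ≤ 3 * (((N ^ 3 : ℕ)) : ℝ) ^ 2 := by
    rw [hN3r]
    have h1 : (N : ℝ) ^ (η - 1) ≤ 1 := Real.rpow_le_one_of_one_le_of_nonpos hn1 (by linarith)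
    have h2 : (M₀ : ℝ) ≤ (1 + T) * 1 + 1 := hM₀hi.trans (by gcongr)
    have h3 : ((N : ℝ) ^ 3) ^ 2 = (N : ℝ) ^ 6 := by ring
    rw [h3]
    calc (M₀ : ℝ) ≤ (1 + T) * 1 + 1 := h2
      _ = T + 2 := by ring
      _ ≤ 3 * T := by linarith
      _ ≤ 3 * (N : ℝ) ^ 6 := by gcongr
  -- Step 1: truncation
  have htrunc : ‖S3 w N W - ∑ m ∈ Mset M₀ ×ˢ (Mset M₀ ×ˢ Mset M₀), Im w N W m‖ ≤
      A₄ * (T ^ 2 * (W.card : ℝ) ^ (3 / 2 : ℝ)) := hA₄ N hn1 T hNT hTA t₀ W hW hKT M₀ hM₀1 hNM₀' hNM₀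
  -- Step 2: the blocks
  set R := Finset.range (Nat.log 2 M₀ + 1) with hR
  set 𝒯 : ℝ := T ^ 2 * (W.card : ℝ) ^ (3 / 2 : ℝ) + T * N * (W.card : ℝ) ^ (1 / 2 : ℝ) * (addEnergy W) ^ (1 / 2 : ℝ)
    with h𝒯
  have h𝒯0 : 0 ≤ 𝒯 := by rw [h𝒯]; positivity
  set negl : ℝ := Cn * ((N : ℝ) ^ 3 * (W.card : ℝ) ^ 3 * (N : ℝ) ^ (-(η * j))) with hnegl
  have hnegl0 : 0 ≤ negl := by rw [hnegl]; positivity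
  have hpow2 : ∀ {i : ℕ}, i ∈ R → (2 : ℝ) ^ i ≤ M₀ := by
    intro i hi
    rw [hR, Finset.mem_range, Nat.lt_succ_iff] at hi
    have : 2 ^ i ≤ M₀ := (Nat.pow_le_pow_right (by norm_num) hi).trans (Nat.pow_log_le_self 2 (by omega))
    exact_mod_cast this
  have hblock' : ∀ b ∈ R ×ˢ (R ×ˢ R),
      ∑ m ∈ shell M₀ b.1 ×ˢ (shell M₀ b.2.1 ×ˢ shell M₀ b.2.2), ‖Im w N W m‖ ≤ A₁ * L ^ 16 * 𝒯 +
        ((shell M₀ b.1 ×ˢ (shell M₀ b.2.1 ×ˢ shell M₀ b.2.2)).card : ℝ) * negl := by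
    rintro ⟨i₁, i₂, i₃⟩ hb
    simp only [Finset.mem_product] at hb
    obtain ⟨hi₁, hi₂, -⟩ := hb
    exact hblock N hNN₁ T hNT hTA t₀ W hW hsep1 M₀ hNM₀ i₁ i₂ i₃ (hpow2 hi₁) (hpow2 hi₂)
  -- sum over the blocks
  have hsum := sum_Mset3_eq_sum_blocks M₀ (fun m ↦ ‖Im w N W m‖)
  have hcard_blocks : ∑ b ∈ R ×ˢ (R ×ˢ R), ((shell M₀ b.1 ×ˢ (shell M₀ b.2.1 ×ˢ shell M₀ b.2.2)).card : ℝ) =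
      ((Mset M₀ ×ˢ (Mset M₀ ×ˢ Mset M₀)).card : ℝ) := by
    have h := sum_Mset3_eq_sum_blocks M₀ (fun _ ↦ (1 : ℝ))
    simp only [Finset.sum_const, nsmul_eq_mul, mul_one] at h
    rw [hR]; exact h.symm
  have hMset_card : ((Mset M₀ ×ˢ (Mset M₀ ×ˢ Mset M₀)).card : ℝ) ≤ (3 * (M₀ : ℝ)) ^ 3 := card_Mset3_le hM₀1
  have eL6 : (((N ^ 3 : ℕ) : ℝ) ^ η) ^ 2 = L ^ 6 := by
    rw [hN3r, hL, ← Real.rpow_natCast (N : ℝ) 3, ← Real.rpow_mul hn0.le, ← Real.rpow_natCast, ← Real.rpow_natCast,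
      ← Real.rpow_mul hn0.le, ← Real.rpow_mul hn0.le]
    congr 1; push_cast; ring
  have hRcard : ((R ×ˢ (R ×ˢ R)).card : ℝ) ≤ ((1 + 6 / η) * L ^ 6) ^ 3 := by
    have h := card_blocks_le hη0 hη1 hn1' hM₀1 hM₀T
    rw [eL6] at h
    rw [hR]; exact h
  have hALT : 0 ≤ A₁ * L ^ 16 * 𝒯 := by positivity
  have hblocks_total : ∑ m ∈ Mset M₀ ×ˢ (Mset M₀ ×ˢ Mset M₀), ‖Im w N W m‖ ≤
      ((1 + 6 / η) * L ^ 6) ^ 3 * (A₁ * L ^ 16 * 𝒯) + (3 * (M₀ : ℝ)) ^ 3 * negl := by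
    rw [hsum, ← hR]
    calc ∑ b ∈ R ×ˢ (R ×ˢ R), ∑ m ∈ shell M₀ b.1 ×ˢ (shell M₀ b.2.1 ×ˢ shell M₀ b.2.2), ‖Im w N W m‖
        ≤ ∑ b ∈ R ×ˢ (R ×ˢ R), (A₁ * L ^ 16 * 𝒯 +
            ((shell M₀ b.1 ×ˢ (shell M₀ b.2.1 ×ˢ shell M₀ b.2.2)).card : ℝ) * negl) := Finset.sum_le_sum hblock'
      _ = ((R ×ˢ (R ×ˢ R)).card : ℝ) * (A₁ * L ^ 16 * 𝒯) +
            (∑ b ∈ R ×ˢ (R ×ˢ R), ((shell M₀ b.1 ×ˢ (shell M₀ b.2.1 ×ˢ shell M₀ b.2.2)).card : ℝ)) * negl := by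
          rw [Finset.sum_add_distrib, Finset.sum_const, nsmul_eq_mul, ← Finset.sum_mul]
      _ ≤ ((1 + 6 / η) * L ^ 6) ^ 3 * (A₁ * L ^ 16 * 𝒯) + (3 * (M₀ : ℝ)) ^ 3 * negl := by
          rw [hcard_blocks]
          gcongr
  -- `T²|W|^{3/2} ≤ 𝒯`
  have hT𝒯 : T ^ 2 * (W.card : ℝ) ^ (3 / 2 : ℝ) ≤ 𝒯 := by
    rw [h𝒯]
    have : 0 ≤ T * N * (W.card : ℝ) ^ (1 / 2 : ℝ) * (addEnergy W) ^ (1 / 2 : ℝ) := by positivity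
    linarith
  -- the negligible total is `≤ A₃ T² |W|^{3/2} ≤ A₃ 𝒯`
  have hK3 : (W.card : ℝ) ^ 3 ≤ 4 * T ^ 2 * (W.card : ℝ) ^ (3 / 2 : ℝ) := cube_le hK0 hT1 hKT
  have hpow3 : T ^ 3 * L ^ 3 * (N : ℝ) ^ (-(η * j)) ≤ 1 := by
    have hT3 : T ^ 3 ≤ (N : ℝ) ^ (18 : ℝ) := by
      calc T ^ 3 ≤ ((N : ℝ) ^ (6 : ℝ)) ^ 3 := pow_le_pow_left₀ hT0.le hTA 3
        _ = (N : ℝ) ^ (18 : ℝ) := by rw [← Real.rpow_natCast, ← Real.rpow_mul hn0.le]; norm_num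
    have eL : L ^ 3 = (N : ℝ) ^ (η * 3) := by rw [hL, ← Real.rpow_natCast, ← Real.rpow_mul hn0.le]; norm_num
    calc T ^ 3 * L ^ 3 * (N : ℝ) ^ (-(η * j)) ≤ (N : ℝ) ^ (18 : ℝ) * L ^ 3 * (N : ℝ) ^ (-(η * j)) := by gcongr
      _ = (N : ℝ) ^ (18 + η * 3 + -(η * j)) := by rw [eL, hnp, hnp]
      _ ≤ (N : ℝ) ^ (0 : ℝ) := hnle (by linarith)
      _ = 1 := Real.rpow_zero _
  have hnegl_total : (3 * (M₀ : ℝ)) ^ 3 * negl ≤ A₃ * 𝒯 := by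
    have hM₀3 : (3 * (M₀ : ℝ)) ^ 3 * (N : ℝ) ^ 3 ≤ 27 * (3 * T * L) ^ 3 := by
      calc (3 * (M₀ : ℝ)) ^ 3 * (N : ℝ) ^ 3 = 27 * ((N : ℝ) * M₀) ^ 3 := by ring
        _ ≤ 27 * (3 * T * L) ^ 3 := by gcongr
    calc (3 * (M₀ : ℝ)) ^ 3 * negl
        = Cn * ((3 * (M₀ : ℝ)) ^ 3 * (N : ℝ) ^ 3) * (W.card : ℝ) ^ 3 * (N : ℝ) ^ (-(η * j)) := by
          simp only [hnegl]; ring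
      _ ≤ Cn * (27 * (3 * T * L) ^ 3) * (4 * T ^ 2 * (W.card : ℝ) ^ (3 / 2 : ℝ)) * (N : ℝ) ^ (-(η * j)) := by
          gcongr
      _ = A₃ * (T ^ 2 * (W.card : ℝ) ^ (3 / 2 : ℝ)) * (T ^ 3 * L ^ 3 * (N : ℝ) ^ (-(η * j))) := by
          simp only [hA₃]; ring
      _ ≤ A₃ * 𝒯 * 1 := by gcongr
      _ = _ := mul_one _
  -- the main total is `≤ A₂ N^δ 𝒯`
  have hLδ : L ^ 34 ≤ (N : ℝ) ^ δ := by
    rw [hL, ← Real.rpow_natCast, ← Real.rpow_mul hn0.le]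
    exact hnle (by push_cast; nlinarith)
  have hNδ1 : 1 ≤ (N : ℝ) ^ δ := hn1le hδ.le
  have hmain_total : ((1 + 6 / η) * L ^ 6) ^ 3 * (A₁ * L ^ 16 * 𝒯) ≤ A₂ * (N : ℝ) ^ δ * 𝒯 := by
    calc ((1 + 6 / η) * L ^ 6) ^ 3 * (A₁ * L ^ 16 * 𝒯) = A₂ * L ^ 34 * 𝒯 := by simp only [hA₂]; ring
      _ ≤ A₂ * (N : ℝ) ^ δ * 𝒯 := by gcongr
  -- assemble
  have hsplit : ‖S3 w N W‖ ≤ ‖S3 w N W - ∑ m ∈ Mset M₀ ×ˢ (Mset M₀ ×ˢ Mset M₀), Im w N W m‖ +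
      ∑ m ∈ Mset M₀ ×ˢ (Mset M₀ ×ˢ Mset M₀), ‖Im w N W m‖ := by
    calc ‖S3 w N W‖ = ‖(S3 w N W - ∑ m ∈ Mset M₀ ×ˢ (Mset M₀ ×ˢ Mset M₀), Im w N W m) +
          ∑ m ∈ Mset M₀ ×ˢ (Mset M₀ ×ˢ Mset M₀), Im w N W m‖ := by rw [sub_add_cancel]
      _ ≤ ‖S3 w N W - ∑ m ∈ Mset M₀ ×ˢ (Mset M₀ ×ˢ Mset M₀), Im w N W m‖ +
          ‖∑ m ∈ Mset M₀ ×ˢ (Mset M₀ ×ˢ Mset M₀), Im w N W m‖ := norm_add_le _ _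
      _ ≤ _ := by gcongr; exact norm_sum_le _ _
  have htrunc' : ‖S3 w N W - ∑ m ∈ Mset M₀ ×ˢ (Mset M₀ ×ˢ Mset M₀), Im w N W m‖ ≤ A₄ * 𝒯 :=
    htrunc.trans (mul_le_mul_of_nonneg_left hT𝒯 hA₄0)
  have hfin : ‖S3 w N W‖ ≤ A₄ * 𝒯 + (A₂ * (N : ℝ) ^ δ * 𝒯 + A₃ * 𝒯) := by
    linarith [hsplit, htrunc', hblocks_total, hnegl_total, hmain_total]
  calc ‖S3 w N W‖ ≤ A₄ * 𝒯 + (A₂ * (N : ℝ) ^ δ * 𝒯 + A₃ * 𝒯) := hfin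
    _ ≤ A₄ * ((N : ℝ) ^ δ * 𝒯) + (A₂ * (N : ℝ) ^ δ * 𝒯 + A₃ * ((N : ℝ) ^ δ * 𝒯)) := by
        have h1 : 𝒯 ≤ (N : ℝ) ^ δ * 𝒯 := by
          calc 𝒯 = 1 * 𝒯 := (one_mul _).symm
            _ ≤ (N : ℝ) ^ δ * 𝒯 := by gcongr
        gcongr
    _ = (A₂ + A₃ + A₄) * (N : ℝ) ^ δ * 𝒯 := by ring


end GuthMaynardS3FreeT

/-! ## Proposition 10.1 as printed (`T` free): statement and proof -/

/-- **Guth–Maynard Proposition 10.1 (Refined `S₃` bound), as printed with `T` free.** "If `W` is a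
`T^ε`-separated set contained in an interval of length `T`, then
`S₃ ⪅_ε T²|W|^{3/2} + TN|W|^{1/2}E(W)^{1/2}`" (eq. (10.1)). Here `S₃ = GuthMaynardFourier.S3 w N W`
(§7; the all-`m_i ≠ 0` part of `tr((M_W M_W^*)³)`, Lemma 4.5) for the cutoff `w` fixed in §3 of the paper
(smooth, supported in `[1,2]`, `= 1` on `[6/5, 9/5]`, values in `[0,1]`; the constant depends on `w`),
`E(W) = GuthMaynardAssembly.addEnergy W` ((2.3)), `N` is in the large-values regime `1 ≤ N ≤ T` of §3
("we may assume `N < T`"), and "`⪅_ε`" (§1.2: up to `T^{o(1)}` factors, constants depending on `ε`)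
is rendered as `∀ δ > 0 ∃ C T₀ ∀ T ≥ T₀ : ‖S₃‖ ≤ C T^δ · (…)`. The tree's `GuthMaynardS3Final.S3_bound`
(`LargeValuesS3Bound.lean`) is the case `T = N^{6/5}` (the standing regime of Proposition 3.1, losses
`N^δ`), which is all that Theorem 1.1 needs; the free-`T` form is the `S₃` input of eq. (12.1) for
Proposition 12.1. Same binder shape as the free-`T` Proposition 8.1
(`GuthMaynardSimpleS3.S3_simple_bound`). PROVED below (`GuthMaynard2026_proposition_10_1_holds`).
[cite: GuthMaynard2026, Proposition 10.1 (eq. (10.1))] -/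
def GuthMaynard2026_proposition_10_1 : Prop :=
  ∀ (w : ℝ → ℝ), ContDiff ℝ ∞ w → Function.support w ⊆ Set.Icc 1 2 →
    (∀ u : ℝ, 6 / 5 ≤ u → u ≤ 9 / 5 → w u = 1) → (∀ u : ℝ, 0 ≤ w u ∧ w u ≤ 1) →
    ∀ ε : ℝ, 0 < ε → ∀ δ : ℝ, 0 < δ → ∃ C T₀ : ℝ, ∀ T : ℝ, T₀ ≤ T → ∀ N : ℕ, 1 ≤ N → (N : ℝ) ≤ T →
    ∀ (t₀ : ℝ) (W : Finset ℝ), (∀ t ∈ W, t₀ ≤ t ∧ t ≤ t₀ + T) →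
    (∀ t ∈ W, ∀ t' ∈ W, t ≠ t' → T ^ ε ≤ |t - t'|) →
    ‖GuthMaynardFourier.S3 w N W‖ ≤ C * T ^ δ *
      (T ^ 2 * (W.card : ℝ) ^ (3 / 2 : ℝ) +
        T * N * (W.card : ℝ) ^ (1 / 2 : ℝ) * (GuthMaynardAssembly.addEnergy W) ^ (1 / 2 : ℝ))

/-- **Guth–Maynard Proposition 10.1 with `T` free, proved.** For `T ≤ N⁶` this is the printed §10
argument re-run with `T` free (`GuthMaynardS3FreeT.S3_bound_of_le_pow_six`, `N^δ ≤ T^δ`); for `N⁶ ≤ T`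
the trivial bound `|S₃| ≪ N³|W|³ ≤ T^{1/2}|W|³ ≤ 3T²|W|^{3/2}` (`GuthMaynardSimpleS3.norm_S3_le_trivial`,
`|W| ≤ 2T`). `T₀ = max(1, max(N₀,1)⁶)` makes the threshold `N ≥ N₀` of the first range automatic; the
`T^ε`-separation is used only through `1`-separation. [cite: GuthMaynard2026, Proposition 10.1] -/
theorem GuthMaynard2026_proposition_10_1_holds : GuthMaynard2026_proposition_10_1 := by
  intro w hw hsupp _hw1 _hw01 ε hε δ hδ
  obtain ⟨C₁, hC₁0, hC₁⟩ := GuthMaynardSimpleS3.norm_S3_le_trivial hw hsupp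
  obtain ⟨C₂, N₀, hC₂0, hC₂⟩ := GuthMaynardS3FreeT.S3_bound_of_le_pow_six hw hsupp δ hδ
  set M : ℝ := max N₀ 1 with hM
  have hM1 : 1 ≤ M := le_max_right _ _
  have hM0 : 0 ≤ M := by linarith
  refine ⟨3 * C₁ + C₂, max 1 (M ^ 6), fun T hT N hN hNT t₀ W hW hsep ↦ ?_⟩
  have hT1 : 1 ≤ T := (le_max_left _ _).trans hT
  have hTM : M ^ 6 ≤ T := (le_max_right _ _).trans hT
  have hT0 : 0 < T := by linarith
  have hn1 : (1 : ℝ) ≤ N := by exact_mod_cast hN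
  have hn0 : (0 : ℝ) < N := by linarith
  have hsep1 : ∀ t ∈ W, ∀ t' ∈ W, t ≠ t' → 1 ≤ |t - t'| := by
    intro t ht t' ht' hne
    have h1 := hsep t ht t' ht' hne
    have h2 : 1 ≤ T ^ ε := Real.one_le_rpow hT1 hε.le
    linarith
  have hK0 : 0 ≤ (W.card : ℝ) := Nat.cast_nonneg _
  have hE0 : 0 ≤ GuthMaynardAssembly.addEnergy W := GuthMaynardAssembly.addEnergy_nonneg W
  have hKT : (W.card : ℝ) ≤ 2 * T := by
    have h := SeparatedSums.card_le_of_sep one_pos (by linarith) W hW hsep1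
    rw [div_one] at h
    linarith
  have hTδ1 : 1 ≤ T ^ δ := Real.one_le_rpow hT1 hδ.le
  set 𝒯 : ℝ := T ^ 2 * (W.card : ℝ) ^ (3 / 2 : ℝ) +
    T * N * (W.card : ℝ) ^ (1 / 2 : ℝ) * (GuthMaynardAssembly.addEnergy W) ^ (1 / 2 : ℝ) with h𝒯
  have h𝒯0 : 0 ≤ 𝒯 := by rw [h𝒯]; positivity
  have hN6 : (N : ℝ) ^ (6 : ℝ) = (N : ℝ) ^ 6 := by
    rw [show (6 : ℝ) = (6 : ℕ) by norm_num, Real.rpow_natCast]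
  rcases le_or_gt T ((N : ℝ) ^ (6 : ℝ)) with hcase | hcase
  · -- the range `T ≤ N⁶`: §10 with `T` free; `N ≥ N₀` because `max(N₀,1)⁶ ≤ T ≤ N⁶`
    have hMN : M ≤ N := by
      have h : M ^ 6 ≤ (N : ℝ) ^ 6 := by rw [← hN6]; exact hTM.trans hcase
      exact le_of_pow_le_pow_left₀ (by norm_num) hn0.le h
    have hN₀N : N₀ ≤ N := (le_max_left _ _).trans hMN
    have h := hC₂ N hN₀N T hNT hcase t₀ W hW hsep1
    have hNδ : (N : ℝ) ^ δ ≤ T ^ δ := Real.rpow_le_rpow hn0.le hNT hδ.le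
    calc ‖GuthMaynardFourier.S3 w N W‖ ≤ C₂ * (N : ℝ) ^ δ * 𝒯 := h
      _ ≤ C₂ * T ^ δ * 𝒯 := by gcongr
      _ ≤ (3 * C₁ + C₂) * T ^ δ * 𝒯 := by gcongr; linarith
  · -- the range `N⁶ ≤ T`: trivial bound
    have hN3 : (N : ℝ) ^ 3 ≤ T ^ (1 / 2 : ℝ) := by
      have h1 : ((N : ℝ) ^ (6 : ℝ)) ^ (1 / 2 : ℝ) ≤ T ^ (1 / 2 : ℝ) :=
        Real.rpow_le_rpow (by positivity) hcase.le (by norm_num)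
      rwa [← Real.rpow_mul hn0.le, show (6 : ℝ) * (1 / 2) = (3 : ℕ) by norm_num, Real.rpow_natCast] at h1
    have hK3 : (W.card : ℝ) ^ 3 ≤ 3 * T ^ (3 / 2 : ℝ) * (W.card : ℝ) ^ (3 / 2 : ℝ) := by
      have e : (W.card : ℝ) ^ 3 = (W.card : ℝ) ^ (3 / 2 : ℝ) * (W.card : ℝ) ^ (3 / 2 : ℝ) := by
        rw [← Real.rpow_add_of_nonneg hK0 (by norm_num) (by norm_num)]; norm_num
      rw [e]
      refine mul_le_mul_of_nonneg_right ?_ (by positivity)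
      calc (W.card : ℝ) ^ (3 / 2 : ℝ) ≤ (2 * T) ^ (3 / 2 : ℝ) := Real.rpow_le_rpow hK0 hKT (by norm_num)
        _ = (2 : ℝ) ^ (3 / 2 : ℝ) * T ^ (3 / 2 : ℝ) := Real.mul_rpow (by norm_num) hT0.le
        _ ≤ 3 * T ^ (3 / 2 : ℝ) := by
            refine mul_le_mul_of_nonneg_right ?_ (by positivity)
            have h3 : ((2 : ℝ) ^ (3 / 2 : ℝ)) ^ 2 = 8 := by
              rw [← Real.rpow_natCast, ← Real.rpow_mul (by norm_num)]; norm_num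
            nlinarith [Real.rpow_nonneg (show (0:ℝ) ≤ 2 by norm_num) (3 / 2 : ℝ)]
    have hT2 : T ^ (1 / 2 : ℝ) * T ^ (3 / 2 : ℝ) = T ^ 2 := by
      rw [← Real.rpow_add hT0]; norm_num
    have hT𝒯 : T ^ 2 * (W.card : ℝ) ^ (3 / 2 : ℝ) ≤ 𝒯 := by
      rw [h𝒯]
      have : 0 ≤ T * N * (W.card : ℝ) ^ (1 / 2 : ℝ) * (GuthMaynardAssembly.addEnergy W) ^ (1 / 2 : ℝ) := by
        positivity
      linarith
    calc ‖GuthMaynardFourier.S3 w N W‖ ≤ C₁ * (N : ℝ) ^ 3 * (W.card : ℝ) ^ 3 := hC₁ N hN W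
      _ ≤ C₁ * T ^ (1 / 2 : ℝ) * (3 * T ^ (3 / 2 : ℝ) * (W.card : ℝ) ^ (3 / 2 : ℝ)) := by gcongr
      _ = 3 * C₁ * 1 * ((T ^ (1 / 2 : ℝ) * T ^ (3 / 2 : ℝ)) * (W.card : ℝ) ^ (3 / 2 : ℝ)) := by ring
      _ ≤ 3 * C₁ * T ^ δ * 𝒯 := by rw [hT2]; gcongr
      _ ≤ (3 * C₁ + C₂) * T ^ δ * 𝒯 := by gcongr; linarith

end Literature.NumberTheory.LFunctions

end
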